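import Mathlib
import HarnessLib

/-!
# Herbst's argument: an entropy bound gives a sub-Gaussian Laplace transform and tail

Pure measure-theoretic probability; everything in this file is proved (no definitions, no
named facts).

Let `ν` be a probability measure, `ψ` a bounded measurable real function with mean
`m = ∫ ψ dν`, and `c > 0`. Suppose that for every real `l` the function `e^{lψ}` satisfies the
entropy inequality

  `Ent_ν(e^{lψ}) = ∫ e^{lψ} (lψ) dν − (∫ e^{lψ} dν) log (∫ e^{lψ} dν) ≤ c l² ∫ e^{lψ} dν`

(this is what a logarithmic Sobolev inequality gives for `f = e^{lψ/2}` when `|∇ψ| ≤ 1`). Then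
(`herbst_laplace_and_tail_bound`)

* `∫ e^{l(ψ − m)} dν ≤ e^{c l²}` for every real `l` (sub-Gaussian Laplace bound,
  `integral_exp_mul_sub_integral_le_of_entropy_le`), and
* `ν {ψ − m ≥ r} ≤ e^{−r²/(4c)}` for every `r ≥ 0` (Gaussian concentration).

This is Herbst's argument (Bakry–Gentil–Ledoux 2014, Prop. 5.4.1 with eq. (5.4.1), and the
measure-concentration reformulation (5.4.2)), in the abstract form in which it enters the
Gaussian concentration of conjugate heat kernel measures along a Ricci flow (Hein–Naber 2014,
§3.2, where `c = |s|` and `U(λ) = λ⁻¹ log ∫ e^{λF} dν` has `U' ≤ |s|`; used again in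
Bamler 2020, §3): the log-Sobolev input is consumed only through the displayed entropy
inequality, so no geometry appears here.

## The argument

With `Z(l) = ∫ e^{lψ} dν = mgf ψ ν l > 0` and `Λ = log Z = cgf ψ ν` (differentiable in `l`
since `ψ` is bounded, `ProbabilityTheory.hasDerivAt_mgf`, with `Z' = ∫ ψ e^{lψ}`), the
hypothesis reads `l Λ'(l) − Λ(l) ≤ c l²`, i.e. `(Λ(l)/l − c l)' ≤ 0` on `(0, ∞)`
(`antitoneOn_of_deriv_nonpos`); since `Λ(l)/l → Λ'(0) = m` as `l → 0⁺`, this gives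
`Λ(l) ≤ l m + c l²` for `l > 0` (`cgf_le_of_entropy_le_of_pos`), and for `l < 0` one applies the
same bound to `−ψ`, under which the hypothesis is invariant (`cgf_le_of_entropy_le`). Hence
`ψ − m` has a sub-Gaussian moment generating function with constant `2c` in Mathlib's
normalisation `mgf ≤ exp (c t² / 2)` (`hasSubgaussianMGF_of_entropy_le`), and the tail bound is
Mathlib's Chernoff bound `ProbabilityTheory.HasSubgaussianMGF.measure_ge_le`.

What is NOT here: logarithmic Sobolev inequalities themselves, Lipschitz functions and
`|∇ψ|`, heat kernels; the hypothesis is the already-integrated entropy inequality for the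
one-parameter family `e^{lψ}`.

## References

* D. Bakry, I. Gentil, M. Ledoux, *Analysis and Geometry of Markov Diffusion Operators*,
  Grundlehren 348, Springer (2014), Prop. 5.4.1, (5.4.1)–(5.4.2). [BakryGentilLedoux2014]
* H.-J. Hein, A. Naber, *New logarithmic Sobolev inequalities and an ε-regularity theorem for
  the Ricci flow*, Comm. Pure Appl. Math. 67 (2014) 1543–1561, §1.3 (Gaussian concentration
  `ν(A)ν(B) ≤ exp(−dist(A,B)²/(8|s|))`) and its proof in §3.2. [HeinNaber2014]
* R. H. Bamler, *Entropy and heat kernel bounds on a Ricci flow background*, arXiv:2008.07093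
  (2020), §3. [Bamler2020Entropy]
-/

namespace Literature.Probability.Moments

open _root_.MeasureTheory _root_.ProbabilityTheory _root_.Real _root_.Filter _root_.Set
open scoped _root_.Topology _root_.NNReal

variable {α : Type*} [MeasurableSpace α]

/-- A bounded measurable function has all exponential moments under a finite measure:
`y ↦ exp (t ψ y)` is integrable for every real `t` when `|ψ| ≤ C`. [folklore] -/
theorem integrable_exp_mul_of_abs_le_const (ν : Measure α) [IsFiniteMeasure ν] {ψ : α → ℝ}
    (hψ : Measurable ψ) {C : ℝ} (hC : ∀ y, |ψ y| ≤ C) (t : ℝ) :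
    Integrable (fun y => exp (t * ψ y)) ν :=
  integrable_exp_mul_of_mem_Icc (a := -C) (b := C) hψ.aemeasurable
    (ae_of_all _ fun y => abs_le.1 (hC y))

section Herbst

variable (ν : Measure α) [IsProbabilityMeasure ν] {ψ : α → ℝ} {C c : ℝ}

/-- **Herbst's argument, positive parameter.** If `ψ` is bounded and measurable, `c > 0`, and
`Ent_ν(e^{lψ}) ≤ c l² ∫ e^{lψ} dν` for every real `l`, then for `l > 0` the cumulant generating
function satisfies `log ∫ e^{lψ} dν ≤ l ∫ ψ dν + c l²`.
[cite: BakryGentilLedoux2014, Prop. 5.4.1] -/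
theorem cgf_le_of_entropy_le_of_pos (hψ : Measurable ψ) (hC : ∀ y, |ψ y| ≤ C) (hc : 0 < c)
    (hEnt : ∀ l : ℝ, ∫ y, exp (l * ψ y) * (l * ψ y) ∂ν -
      (∫ y, exp (l * ψ y) ∂ν) * log (∫ y, exp (l * ψ y) ∂ν) ≤
        c * l ^ 2 * ∫ y, exp (l * ψ y) ∂ν)
    {l : ℝ} (hl : 0 < l) :
    cgf ψ ν l ≤ l * ∫ z, ψ z ∂ν + c * l ^ 2 := by
  have hint : ∀ t : ℝ, Integrable (fun y => exp (t * ψ y)) ν :=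
    integrable_exp_mul_of_abs_le_const ν hψ hC
  have hmem : ∀ t : ℝ, t ∈ interior (integrableExpSet ψ ν) := fun t => by
    rw [(eq_univ_of_forall hint : integrableExpSet ψ ν = univ), interior_univ]
    exact mem_univ t
  have hZ : ∀ t, 0 < mgf ψ ν t := fun t => mgf_pos (hint t)
  -- `Λ = cgf ψ ν` is differentiable with derivative `Λ' = Z' / Z`
  set Λ' : ℝ → ℝ := fun t => (∫ y, ψ y * exp (t * ψ y) ∂ν) / mgf ψ ν t with hΛ'
  have hΛd : ∀ t, HasDerivAt (cgf ψ ν) (Λ' t) t := fun t =>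
    (hasDerivAt_mgf (hmem t)).log (hZ t).ne'
  -- the hypothesis reads `t Λ' t - Λ t ≤ c t²`
  have hkey : ∀ t, t * Λ' t - cgf ψ ν t ≤ c * t ^ 2 := fun t => by
    have h := hEnt t
    have h2 : ∫ y, exp (t * ψ y) * (t * ψ y) ∂ν = t * ∫ y, ψ y * exp (t * ψ y) ∂ν := by
      rw [← integral_const_mul]
      exact integral_congr_ae (ae_of_all _ fun y => by ring)
    rw [h2] at h
    change t * (∫ y, ψ y * exp (t * ψ y) ∂ν) - mgf ψ ν t * log (mgf ψ ν t) ≤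
      c * t ^ 2 * mgf ψ ν t at h
    have hZt := hZ t
    have hI : ∫ y, ψ y * exp (t * ψ y) ∂ν = Λ' t * mgf ψ ν t := by
      rw [hΛ', div_mul_cancel₀ _ hZt.ne']
    rw [hI] at h
    have h' : mgf ψ ν t * (t * Λ' t - log (mgf ψ ν t) - c * t ^ 2) ≤ 0 := by nlinarith [h]
    exact sub_nonpos.1 (nonpos_of_mul_nonpos_right h' hZt)
  -- `K t = Λ t / t - c t` is non-increasing on `(0, ∞)`
  set K : ℝ → ℝ := fun t => cgf ψ ν t / t - c * t with hK
  have hKd : ∀ t, t ≠ 0 →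
      HasDerivAt K ((Λ' t * t - cgf ψ ν t * 1) / t ^ 2 - c * 1) t := fun t ht =>
    ((hΛd t).div (hasDerivAt_id' t) ht).sub ((hasDerivAt_id' t).const_mul c)
  have hanti : AntitoneOn K (Ioi 0) := by
    refine antitoneOn_of_deriv_nonpos (convex_Ioi 0)
      (fun t ht => (hKd t (ne_of_gt ht)).continuousAt.continuousWithinAt)
      (fun t ht => (hKd t (ne_of_gt (interior_subset ht))).differentiableAt.differentiableWithinAt)
      fun t ht => ?_
    rw [interior_Ioi] at ht
    have ht' : (0 : ℝ) < t := ht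
    rw [(hKd t ht'.ne').deriv, mul_one, mul_one, sub_nonpos, div_le_iff₀ (pow_pos ht' 2)]
    have := hkey t
    linarith
  -- `K t → Λ' 0 = m` as `t → 0⁺`
  have h0 : cgf ψ ν 0 = 0 := cgf_zero
  have hΛ'0 : Λ' 0 = ∫ z, ψ z ∂ν := by simp [hΛ']
  have htend : Tendsto (fun s => cgf ψ ν s / s) (𝓝[>] 0) (𝓝 (∫ z, ψ z ∂ν)) := by
    have h := hΛd 0
    rw [hasDerivAt_iff_tendsto_slope_zero, hΛ'0] at h
    simp only [zero_add, h0, sub_zero, smul_eq_mul] at h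
    refine (h.mono_left (nhdsGT_le_nhdsNE 0)).congr fun s => ?_
    rw [inv_mul_eq_div]
  have hKl : K l ≤ ∫ z, ψ z ∂ν := by
    refine ge_of_tendsto htend ?_
    filter_upwards [Ioo_mem_nhdsGT hl] with s hs
    have h1 : K l ≤ K s := hanti hs.1 hl hs.2.le
    have h2 : K s ≤ cgf ψ ν s / s := by
      have : 0 ≤ c * s := mul_nonneg hc.le hs.1.le
      simp only [hK]
      linarith
    exact h1.trans h2
  have hKl' : cgf ψ ν l / l - c * l ≤ ∫ z, ψ z ∂ν := hKl
  rw [sub_le_iff_le_add, div_le_iff₀ hl] at hKl'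
  nlinarith [hKl']

/-- **Herbst's argument, all parameters.** If `ψ` is bounded and measurable, `c > 0`, and
`Ent_ν(e^{lψ}) ≤ c l² ∫ e^{lψ} dν` for every real `l`, then
`log ∫ e^{lψ} dν ≤ l ∫ ψ dν + c l²` for every real `l` (the case `l < 0` is the case `l > 0`
for `−ψ`). [cite: BakryGentilLedoux2014, Prop. 5.4.1] -/
theorem cgf_le_of_entropy_le (hψ : Measurable ψ) (hC : ∀ y, |ψ y| ≤ C) (hc : 0 < c)
    (hEnt : ∀ l : ℝ, ∫ y, exp (l * ψ y) * (l * ψ y) ∂ν -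
      (∫ y, exp (l * ψ y) ∂ν) * log (∫ y, exp (l * ψ y) ∂ν) ≤
        c * l ^ 2 * ∫ y, exp (l * ψ y) ∂ν)
    (l : ℝ) :
    cgf ψ ν l ≤ l * ∫ z, ψ z ∂ν + c * l ^ 2 := by
  rcases lt_trichotomy 0 l with hl | rfl | hl
  · exact cgf_le_of_entropy_le_of_pos ν hψ hC hc hEnt hl
  · simp [cgf_zero]
  · have hEnt' : ∀ t : ℝ, ∫ y, exp (t * (-ψ) y) * (t * (-ψ) y) ∂ν -
        (∫ y, exp (t * (-ψ) y) ∂ν) * log (∫ y, exp (t * (-ψ) y) ∂ν) ≤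
          c * t ^ 2 * ∫ y, exp (t * (-ψ) y) ∂ν := fun t => by
      simpa using hEnt (-t)
    have h := cgf_le_of_entropy_le_of_pos ν (ψ := -ψ) hψ.neg (C := C)
      (fun y => by simpa using hC y) hc hEnt' (neg_pos.2 hl)
    rw [cgf_neg, neg_neg] at h
    simpa [integral_neg] using h

/-- **Sub-Gaussian Laplace bound from an entropy bound** (Herbst): if `ψ` is bounded and
measurable, `c > 0`, and `Ent_ν(e^{lψ}) ≤ c l² ∫ e^{lψ} dν` for every real `l`, then
`∫ exp (l (ψ − ∫ ψ dν)) dν ≤ exp (c l²)` for every real `l`.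
[cite: BakryGentilLedoux2014, Prop. 5.4.1] -/
theorem integral_exp_mul_sub_integral_le_of_entropy_le (hψ : Measurable ψ)
    (hC : ∀ y, |ψ y| ≤ C) (hc : 0 < c)
    (hEnt : ∀ l : ℝ, ∫ y, exp (l * ψ y) * (l * ψ y) ∂ν -
      (∫ y, exp (l * ψ y) ∂ν) * log (∫ y, exp (l * ψ y) ∂ν) ≤
        c * l ^ 2 * ∫ y, exp (l * ψ y) ∂ν)
    (l : ℝ) :
    ∫ y, exp (l * (ψ y - ∫ z, ψ z ∂ν)) ∂ν ≤ exp (c * l ^ 2) := by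
  have h := cgf_le_of_entropy_le ν hψ hC hc hEnt l
  have hint := integrable_exp_mul_of_abs_le_const ν hψ hC l
  calc ∫ y, exp (l * (ψ y - ∫ z, ψ z ∂ν)) ∂ν = exp (-(l * ∫ z, ψ z ∂ν)) * mgf ψ ν l := by
        rw [mgf, ← integral_const_mul]
        refine integral_congr_ae (ae_of_all _ fun y => ?_)
        show exp (l * (ψ y - ∫ z, ψ z ∂ν)) = exp (-(l * ∫ z, ψ z ∂ν)) * exp (l * ψ y)
        rw [← exp_add]
        congr 1
        ring
    _ = exp (-(l * ∫ z, ψ z ∂ν) + cgf ψ ν l) := by rw [exp_add, exp_cgf hint]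
    _ ≤ exp (c * l ^ 2) := exp_le_exp.2 (by linarith)

/-- **Sub-Gaussian moment generating function from an entropy bound** (Herbst): under the
hypotheses of `integral_exp_mul_sub_integral_le_of_entropy_le`, the centred variable
`ψ − ∫ ψ dν` has a sub-Gaussian moment generating function with constant `2c` in Mathlib's
normalisation (`mgf ≤ exp (2c · t² / 2) = exp (c t²)`).
[cite: BakryGentilLedoux2014, Prop. 5.4.1] -/
theorem hasSubgaussianMGF_of_entropy_le (hψ : Measurable ψ) (hC : ∀ y, |ψ y| ≤ C) (hc : 0 < c)
    (hEnt : ∀ l : ℝ, ∫ y, exp (l * ψ y) * (l * ψ y) ∂ν -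
      (∫ y, exp (l * ψ y) ∂ν) * log (∫ y, exp (l * ψ y) ∂ν) ≤
        c * l ^ 2 * ∫ y, exp (l * ψ y) ∂ν) :
    HasSubgaussianMGF (fun y => ψ y - ∫ z, ψ z ∂ν) ⟨2 * c, (mul_pos two_pos hc).le⟩ ν where
  integrable_exp_mul t := by
    refine integrable_exp_mul_of_abs_le_const ν (hψ.sub_const _) (C := C + |∫ z, ψ z ∂ν|)
      (fun y => ?_) t
    exact (abs_sub _ _).trans (by linarith [hC y])
  mgf_le t := by
    refine (integral_exp_mul_sub_integral_le_of_entropy_le ν hψ hC hc hEnt t).trans_eq ?_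
    congr 1
    show c * t ^ 2 = 2 * c * t ^ 2 / 2
    ring

end Herbst

/-- **Herbst's argument** (Bakry–Gentil–Ledoux 2014, Prop. 5.4.1 and (5.4.2); the
probabilistic step of the Gaussian concentration of conjugate heat kernel measures,
Hein–Naber 2014, §3.2). Let `ν` be a probability measure, `ψ` bounded measurable with mean
`m = ∫ ψ dν`, and `c > 0` such that for every real `l`
`Ent_ν(e^{lψ}) = ∫ e^{lψ} lψ dν − (∫ e^{lψ} dν) log ∫ e^{lψ} dν ≤ c l² ∫ e^{lψ} dν`.
Then `∫ e^{l(ψ − m)} dν ≤ e^{c l²}` for every real `l`, and `ν {ψ − m ≥ r} ≤ e^{−r²/(4c)}` for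
every `r ≥ 0` (Chernoff with `l = r/(2c)`). [cite: BakryGentilLedoux2014, Prop. 5.4.1] -/
theorem herbst_laplace_and_tail_bound (ν : Measure α) [IsProbabilityMeasure ν] {ψ : α → ℝ}
    (hψ : Measurable ψ) (hbdd : ∃ C : ℝ, ∀ y, |ψ y| ≤ C) {c : ℝ} (hc : 0 < c)
    (hEnt : ∀ l : ℝ, ∫ y, Real.exp (l * ψ y) * (l * ψ y) ∂ν -
      (∫ y, Real.exp (l * ψ y) ∂ν) * Real.log (∫ y, Real.exp (l * ψ y) ∂ν) ≤
        c * l ^ 2 * ∫ y, Real.exp (l * ψ y) ∂ν) :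
    (∀ l : ℝ, ∫ y, Real.exp (l * (ψ y - ∫ z, ψ z ∂ν)) ∂ν ≤ Real.exp (c * l ^ 2)) ∧
    (∀ r : ℝ, 0 ≤ r →
      ν.real {y | r ≤ ψ y - ∫ z, ψ z ∂ν} ≤ Real.exp (-r ^ 2 / (4 * c))) := by
  obtain ⟨C, hC⟩ := hbdd
  refine ⟨integral_exp_mul_sub_integral_le_of_entropy_le ν hψ hC hc hEnt, fun r hr => ?_⟩
  refine ((hasSubgaussianMGF_of_entropy_le ν hψ hC hc hEnt).measure_ge_le hr).trans_eq ?_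
  congr 1
  show -r ^ 2 / (2 * (2 * c)) = -r ^ 2 / (4 * c)
  ring

end Literature.Probability.Moments
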